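import Mathlib.Analysis.Matrix.Order
import Mathlib.LinearAlgebra.Matrix.Trace
import Literature.Analysis.PDE.ABPEllipticBound

/-!
# One-body Toeplitz sections: the Pauli geometry a window or clique can certify

HONEST FRAMING: first certified bounds; not a superconductivity verdict; every number certified
or labelled float.  (Venture `CertifiedManyBodySolver`, programme `hubbard-alg`, team M1 seat 4,
structure notes `STRUCTURE-TM1-doped.md` §E″/§E‴, conjectures C-M1D-3 and C-M1D-4.)

For a translation-invariant (pseudo-)state of the Hubbard chain the one-body data on a block of
`S` consecutive sites is an even sequence `g : ℕ → ℝ` (`g v = ω(c†_{x+v,σ} c_{x,σ})`, `g 0 = n/2`)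
whose symmetric Toeplitz section `T_S(g) = [g |x−y|]` satisfies `0 ⪯ T_S(g) ⪯ 1` (Gram matrices of
`{c_y ψ}` and, by the CAR, of `{c†_y ψ}`).  The *section value*
`E¹_[S](n) := min { −4 g 1 : g 0 = n/2, 0 ⪯ T_S(g) ⪯ 1 }` is what a one-body clique of `S` sites
certifies for the kinetic energy (C-M1D-3).  This file proves, over `Matrix.PosSemidef`:

* `hop_le_diag` — `0 ⪯ T_S(g)`, `S ≥ 2` ⇒ `g 1 ≤ g 0` (so `E¹_[S](n) ≥ −2tn`);
* `eq_diag_of_hop_eq`, `threshold_of_hop_eq` — if moreover `g 1 = g 0` then `g` is constant on the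
  block and `1 − T_S(g) ⪰ 0` forces `g 0 · S ≤ 1`, i.e. `E¹_[S](n) = −2tn ⇒ n·S ≤ 2`
  (C-M1D-3 (C); the block version of the band-bottom threshold of `BandBottomBlindness.lean`);
* `trace_certificate_le`, `hop_le_of_certificate` — the dual-certificate inequality behind
  C-M1D-4(a): for `A, B ⪰ 0` and `0 ⪯ T ⪯ 1`, `tr((B − A) T) ≤ tr B`; hence any pair `(A, B)` whose
  pairing with every section is `c·tr(B − A) + 4·g 1` bounds `g 1` by `(tr B − c·tr(B − A))/4`.

C-M1D-4(a) itself — `E¹_[S](n) = −(4/S)·sin(πn/2)/sin(π/S)` when `nS/2 ∈ {1,…,S−1}` — is proved on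
paper (`structure/ob2/C-M1D-4a-PROOF.md`: the certificate is Grünbaum's Jacobi matrix commuting with
the periodic discrete prolate projector; identities machine-checked to `1e-51`), not here: the two
spectral facts (commutation and the oscillation count) are the informal residue of
`hop_le_of_certificate`.
-/

namespace Summit.Ventures.CertifiedManyBodySolver.Conjectures

open Matrix

/-- The `S × S` symmetric Toeplitz section of a one-body sequence `g`: entry `(x, y) ↦ g |x − y|`
(written with truncated subtraction: one of the two summands is `0`). -/
def toeplitzSection (S : ℕ) (g : ℕ → ℝ) : Matrix (Fin S) (Fin S) ℝ :=
  Matrix.of fun x y : Fin S => g (((x : ℕ) - y) + ((y : ℕ) - x))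

variable {S : ℕ} {g : ℕ → ℝ}

/-- Entries of the Toeplitz section. -/
@[simp] theorem toeplitzSection_apply (x y : Fin S) :
    toeplitzSection S g x y = g (((x : ℕ) - y) + ((y : ℕ) - x)) := rfl

/-- A `2 × 2` real matrix `[[a, b], [b, a]] ⪰ 0` has `b ≤ a`. -/
theorem le_of_posSemidef_two {a b : ℝ}
    (h : (!![a, b; b, a] : Matrix (Fin 2) (Fin 2) ℝ).PosSemidef) : b ≤ a := by
  have := (Matrix.posSemidef_iff_dotProduct_mulVec.mp h).2 ![1, -1]
  simp [Matrix.mulVec, dotProduct, Fin.sum_univ_two] at this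
  linarith

/-- A `1 × 1` real matrix `[[a]] ⪰ 0` has `0 ≤ a`. -/
theorem nonneg_of_posSemidef_one {a : ℝ}
    (h : (!![a] : Matrix (Fin 1) (Fin 1) ℝ).PosSemidef) : 0 ≤ a := by
  have := (Matrix.posSemidef_iff_dotProduct_mulVec.mp h).2 ![1]
  simpa [Matrix.mulVec, dotProduct] using this

/-- If `∀ t, 0 ≤ 2·t·d + t²·c` with `c ≥ 0` then `d = 0` (take `t = −d/(c+1)`). -/
theorem eq_zero_of_quadratic_nonneg {c d : ℝ} (hc : 0 ≤ c)
    (h : ∀ t : ℝ, 0 ≤ 2 * t * d + t ^ 2 * c) : d = 0 := by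
  have hc1 : 0 < c + 1 := by linarith
  have key : 2 * (-d / (c + 1)) * d + (-d / (c + 1)) ^ 2 * c
      = -(d ^ 2 * (c + 2)) / (c + 1) ^ 2 := by
    field_simp
    ring
  have h0 := h (-d / (c + 1))
  rw [key] at h0
  have hY : 0 < (c + 1) ^ 2 := by positivity
  have hX : d ^ 2 * (c + 2) ≤ 0 := by
    by_contra hlt
    have hlt' : 0 < d ^ 2 * (c + 2) := lt_of_not_ge hlt
    have : -(d ^ 2 * (c + 2)) / (c + 1) ^ 2 < 0 := div_neg_of_neg_of_pos (by linarith) hY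
    linarith
  have hd2 : d ^ 2 ≤ 0 := by nlinarith [sq_nonneg d]
  exact pow_eq_zero_iff (n := 2) (by norm_num) |>.mp (le_antisymm hd2 (sq_nonneg d))

/-- **`E¹ ≥ −2tn`.** A positive semidefinite Toeplitz section on at least two sites has
`g 1 ≤ g 0` (the `2 × 2` principal minor on sites `0, 1`). -/
theorem hop_le_diag (hS : 2 ≤ S) (hT : (toeplitzSection S g).PosSemidef) : g 1 ≤ g 0 := by
  let f : Fin 2 → Fin S := ![⟨0, by omega⟩, ⟨1, by omega⟩]
  have h2 := hT.submatrix f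
  have hmat : (toeplitzSection S g).submatrix f f = !![g 0, g 1; g 1, g 0] := by
    ext i j
    fin_cases i <;> fin_cases j <;> simp [f]
  rw [hmat] at h2
  exact le_of_posSemidef_two h2

/-- The diagonal value of a positive semidefinite section on at least one site is `≥ 0`. -/
theorem diag_nonneg (hS : 1 ≤ S) (hT : (toeplitzSection S g).PosSemidef) : 0 ≤ g 0 := by
  let f : Fin 1 → Fin S := ![⟨0, by omega⟩]
  have h1 := hT.submatrix f
  have hmat : (toeplitzSection S g).submatrix f f = !![g 0] := by
    ext i j
    fin_cases i; fin_cases j; simp [f]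
  rw [hmat] at h1
  exact nonneg_of_posSemidef_one h1

/-- **Kernel propagation.** If `0 ⪯ T_S(g)` and the nearest-neighbour value saturates, `g 1 = g 0`,
then `g` is constant on the whole block: `g v = g 0` for every `v < S` (the `3 × 3` principal minor on
sites `v, v+1, 0` with test vector `(1, −1, t)`). -/
theorem eq_diag_of_hop_eq (hT : (toeplitzSection S g).PosSemidef) (h01 : g 1 = g 0) :
    ∀ v, v < S → g v = g 0 := by
  intro v
  induction v with
  | zero => intro _; rfl
  | succ v ih =>
    intro hv
    have hgv : g v = g 0 := ih (by omega)
    have hS1 : 1 ≤ S := by omega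
    have hg0 : 0 ≤ g 0 := diag_nonneg hS1 hT
    let f : Fin 3 → Fin S := ![⟨v, by omega⟩, ⟨v + 1, hv⟩, ⟨0, by omega⟩]
    have h3 := hT.submatrix f
    have hmat : (toeplitzSection S g).submatrix f f
        = !![g 0, g 0, g 0; g 0, g 0, g (v + 1); g 0, g (v + 1), g 0] := by
      ext i j
      fin_cases i <;> fin_cases j <;> simp [f, h01, hgv]
    rw [hmat] at h3
    have hq : ∀ t : ℝ, 0 ≤ 2 * t * (g 0 - g (v + 1)) + t ^ 2 * g 0 := by
      intro t
      have := (Matrix.posSemidef_iff_dotProduct_mulVec.mp h3).2 ![1, -1, t]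
      simp [Matrix.mulVec, dotProduct, Fin.sum_univ_three] at this
      nlinarith [this]
    have := eq_zero_of_quadratic_nonneg hg0 hq
    linarith

/-- **Band-bottom threshold for sections (C-M1D-3 (C)).** If `0 ⪯ T_S(g) ⪯ 1` and `g 1 = g 0`
(i.e. the section value sits at the band bottom `−4 g 1 = −2tn` with `g 0 = n/2`), then
`g 0 · S ≤ 1`, i.e. `n · S ≤ 2`: test `1 − T_S(g) ⪰ 0` against the all-ones vector after
`eq_diag_of_hop_eq` has made every entry equal to `g 0`. -/
theorem threshold_of_hop_eq (hT : (toeplitzSection S g).PosSemidef)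
    (hI : (1 - toeplitzSection S g).PosSemidef) (h01 : g 1 = g 0) : g 0 * S ≤ 1 := by
  rcases Nat.eq_zero_or_pos S with hS0 | hSpos
  · subst hS0; simp
  have hall := eq_diag_of_hop_eq hT h01
  have hTc : toeplitzSection S g = Matrix.of fun _ _ : Fin S => g 0 := by
    ext x y
    simp only [toeplitzSection_apply, Matrix.of_apply]
    exact hall _ (by omega)
  have hq := (Matrix.posSemidef_iff_dotProduct_mulVec.mp hI).2 (fun _ => (1 : ℝ))
  rw [hTc] at hq
  have hcomp : (fun _ : Fin S => (1 : ℝ)) ⬝ᵥ ((1 - Matrix.of fun _ _ : Fin S => g 0) *ᵥ fun _ => 1)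
      = (S : ℝ) * (1 - g 0 * S) := by
    simp [Matrix.mulVec, dotProduct, Matrix.one_apply, Finset.sum_const, Finset.card_univ,
      Fintype.card_fin]
    ring
  have hstar : star (fun _ : Fin S => (1 : ℝ)) = fun _ => (1 : ℝ) := by
    ext; simp
  rw [hstar, hcomp] at hq
  have hSR : (0 : ℝ) < S := by exact_mod_cast hSpos
  nlinarith

/-- **The dual-certificate inequality (C-M1D-4, abstract form).** For real matrices `A, B ⪰ 0` and
`0 ⪯ T ⪯ 1`: `tr((B − A)·T) ≤ tr B` (drop `tr(A T) ≥ 0` and `tr(B (1 − T)) ≥ 0`). -/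
theorem trace_certificate_le {ι : Type*} [Fintype ι] [DecidableEq ι] {A B T : Matrix ι ι ℝ}
    (hA : A.PosSemidef) (hB : B.PosSemidef) (hT : T.PosSemidef) (hIT : (1 - T).PosSemidef) :
    ((B - A) * T).trace ≤ B.trace := by
  have h1 : 0 ≤ (A * T).trace := Literature.Analysis.PDE.ABP.trace_mul_nonneg_of_posSemidef hA hT
  have h2 : 0 ≤ (B * (1 - T)).trace :=
    Literature.Analysis.PDE.ABP.trace_mul_nonneg_of_posSemidef hB hIT
  have e1 : ((B - A) * T).trace = (B * T).trace - (A * T).trace := by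
    rw [Matrix.sub_mul, Matrix.trace_sub]
  have e2 : (B * (1 - T)).trace = B.trace - (B * T).trace := by
    rw [Matrix.mul_sub, Matrix.mul_one, Matrix.trace_sub]
  linarith

/-- **Section value from a certificate.** If `(A, B)` are positive semidefinite and pair with the
section of `g` as `tr((B − A)·T_S(g)) = c·tr(B − A) + 4·g 1` (for the Grünbaum certificate this is
the statement that `B − A` is tridiagonal with hopping sum `2`, and `g 0 = c`), then feasibility
`0 ⪯ T_S(g) ⪯ 1` gives `4·g 1 ≤ tr B − c·tr(B − A)`.  With the value attained by the twisted
plane-wave projector this is `E¹_[S](n) = f_S(n)` (C-M1D-4(a), paper proof). -/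
theorem hop_le_of_certificate {A B : Matrix (Fin S) (Fin S) ℝ} {c : ℝ}
    (hA : A.PosSemidef) (hB : B.PosSemidef)
    (hT : (toeplitzSection S g).PosSemidef) (hI : (1 - toeplitzSection S g).PosSemidef)
    (hpair : ((B - A) * toeplitzSection S g).trace = c * (B - A).trace + 4 * g 1) :
    4 * g 1 ≤ B.trace - c * (B - A).trace := by
  have := trace_certificate_le hA hB hT hI
  linarith

end Summit.Ventures.CertifiedManyBodySolver.Conjectures
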